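import Literature.NumberTheory.Rogawski1990.EndoscopicTorusRankTwo
import Literature.NumberTheory.Rogawski1990.KottwitzSteinbergRankThree
import Literature.NumberTheory.Automorphic.LocalHermitianPlaneAnisotropic
import Literature.NumberTheory.Automorphic.UnitaryGroupLocalCongr
import Literature.NumberTheory.Automorphic.AdelicUnitaryGroupDatum
import HarnessLib

/-!
# Every class of the elliptic endoscopic torus `U(1) × U(1)` has a `↔`-partner in `U(H)`, `H` a hermitian PLANE — rationally and
# locally — and at most two torus elements lie over one element of `U(H)` (Rogawski (1990), §3.2 p. 19, §4.6 Prop. 4.6.1,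
# §5.4 pp. 72–73, §14.1 p. 232)

Topic `NumberTheory/Rogawski1990`; namespace `Literature.NumberTheory.Rogawski1990`.  THEOREMS ONLY (no definition, no named fact, no instance, no
notation).  The theorems-only half of the «endoscopic embedding ∕ class transfer `T → U(H)`» row of the `N = 2` edition of the cell `hodgecm-mathlib`
(F0P5-p01 (g5) census `CENSUS-N2-edition.v1` §3 (f); F0P5-plan (g2) desk word #14): over ★ `torusEmb₂ : U(σ, Φ₁) × U(σ, Φ₁) →* U(σ, Φ₂)`
(`EndoscopicTorusRankTwo`) and ★ `Corresponds` (`StableConjugacyU3`: `γ′ ↔ γ` iff conjugate in the common `GL₂`) ONLY; the definitions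
`EndoscopicEmbedding₂` ∕ `IsNormPair₂` (the other half of that row) are the LEAD's pen and are NOT introduced here.

[Rogawski1990, §3.2 p. 19 and §14.1 p. 232]: a (stable) class of the quasi-split group «occurs» in an inner form `G′ = U(H)` when some `γ′ ∈ G′` is
conjugate to it over the algebraic closure (here: in `GL₂`); [§4.6 Prop. 4.6.1]: the elliptic endoscopic group of `U(2)` is the torus `U(1) × U(1)`,
embedded as `(u₁, u₂) ↦ P diag(u₁, u₂) P⁻¹`; [§5.4 pp. 72–73]: over a class of a Cartan subgroup the ambiguity upstairs is the Weyl group (here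
`(u₁, u₂) ↔ (u₂, u₁)`).  In rank `2` EVERY torus class occurs in EVERY `U(H)`: a non-degenerate hermitian plane is diagonalisable, `ᵗσ(g) H g = diag(d₁, d₂)`,
and `g · diag(u₁, u₂) · g⁻¹ ∈ U(H)` whenever `σ(u_i) u_i = 1` (diagonal matrices commute) — in contrast with rank `3`, where the partner of an
endoscopic class in an anisotropic `U(H)` may fail to exist.

* §1 (any commutative ring `K`, any `σ`, ANY index type): `diagonal_mem_unitaryGroup_diagonal` (`diag(u) ∈ U(σ, diag(d))` when `σ(u_i) u_i = 1`),
  `exists_corresponds_diagonal_of_formCongr_eq_diagonal` ∕ `exists_isConj_mem_unitaryGroup_of_formCongr_eq_diagonal` (for `ᵗσ(g) H g = diag(d)`: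
  `g · diag(u) · g⁻¹ ∈ U(σ, H)` is a `↔`-partner, via ★ `unitaryGroupCongr` ∕ ★ `corresponds_unitaryGroupCongr`).
* §2 (field `K`, `2 ≠ 0`): `torusGL_mul_frame_eq` (`torusGL(u) · P = P · diag(u₁, u₂)`, `P = (1 1; 1 −1)`), `isConj_torusGL_of_coe_eq_diagonal`;
  **`exists_corresponds_torusEmb₂_of_formCongr_eq_diagonal`** — every torus class has a partner in `U(σ, H)` for a DIAGONALISABLE plane `H`;
  the WEYL FIBRE: `eq_of_corresponds_torusEmb₂_of_fst_apply_eq`, `injOn_fst_apply_setOf_corresponds_torusEmb₂`, `mapsTo_fst_apply_setOf_corresponds_torusEmb₂`,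
  `finite_setOf_corresponds_torusEmb₂`,
  **`ncard_setOf_corresponds_torusEmb₂_le_two`** (at most two torus elements over a given `γ ∈ U(σ, H)`).
* §3 (CM field `L`, `c`): `exists_formCongr_eq_diagonal_two` (a non-zero `c`-hermitian PLANE is diagonalisable: ★ `exists_hermForm_self_ne_zero` + ★
  `exists_formCongr_eq_diagTwo_of_hermForm_self_ne_zero`); **`exists_corresponds_torusEmb₂_two`** (RATIONAL partner in `U(H)(L⁺)` for every torus
  element and every non-zero hermitian plane `H`), `occursIn_stableClassOf_torusEmb₂_two`; **`exists_isConj_mem_cmDatum_local_two`** (LOCAL partner in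
  `U(H)(L⁺_v)` of every diagonal `diag(w₁, w₂) ∈ GL₂(L ⊗ L⁺_v)` with `(c ⊗ 1)(w_i) w_i = 1`, through the local image ★ `adelicForm_formCongr_map_adeleToLocal`
  of a rational diagonalisation — the local torus embedding over `L ⊗ L⁺_v` is a definition left to the LEAD; its image is conjugate to such a diagonal).

HONEST LABEL: HC_CM is proved only modulo the printed citations until rung 0 closes; this file is unconditional and proves no cell binder.

## References
* [Rogawski1990] J. Rogawski, Ann. of Math. Stud. 123 (1990), §3.2 p. 19, §4.6 Prop. 4.6.1, §5.4 pp. 72–73, §14.1 p. 232.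
* [PlatonovRapinchuk1994] V. Platonov, A. Rapinchuk, *Algebraic groups and number theory* (1994), §2.3 (unitary groups of congruent forms).
* [Scharlau1985HermitianForms] W. Scharlau, *Quadratic and Hermitian Forms* (1985), Ch. 7 §6 and Ch. 10 §1 (diagonalisation of hermitian forms).
-/

set_option autoImplicit false

noncomputable section

namespace Literature.NumberTheory.Rogawski1990

open scoped MatrixGroups Matrix
open Polynomial NumberField IsDedekindDomain
open Literature.AlgebraicGeometry.ShimuraVarieties (unitaryGroup mem_unitaryGroup_iff hermForm)
open Literature.NumberTheory.Automorphic (formCongr unitaryGroupCongr coe_unitaryGroupCongr cmConjRingHom cmConjRingHom_apply)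

/-! ## §1 Diagonal partners over a commutative ring -/

section CommRing

variable {K : Type*} [CommRing K] {n : Type*} [Fintype n] [DecidableEq n] (σ : K →+* K)

/-- **`diag(u) ∈ U(σ, diag(d))` when `σ(u_i) · u_i = 1` for all `i`** (diagonal matrices commute; no condition on `d`).
[cite: Rogawski1990, §4.6 Prop. 4.6.1] -/
theorem diagonal_mem_unitaryGroup_diagonal (U : GL n K) (u : n → K) (hU : (U : Matrix n n K) = Matrix.diagonal u)
    (hu : ∀ i, σ (u i) * u i = 1) (d : n → K) : U ∈ unitaryGroup σ (Matrix.diagonal d) := by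
  rw [mem_unitaryGroup_iff, hU, Matrix.diagonal_map (map_zero σ), Matrix.diagonal_transpose, Matrix.diagonal_mul_diagonal,
    Matrix.diagonal_mul_diagonal]
  congr 1
  funext i
  calc σ (u i) * d i * u i = d i * (σ (u i) * u i) := by ring
    _ = d i := by rw [hu i, mul_one]

/-- **A diagonal unitary matrix has a `↔`-partner in `U(σ, H)` for every DIAGONALISABLE `H`**: if `ᵗσ(g) · H · g = diag(d)` and
`σ(u_i) u_i = 1`, then `g · diag(u) · g⁻¹ ∈ U(σ, H)` corresponds to `diag(u) ∈ U(σ, diag(d))` (★ `unitaryGroupCongr`, ★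
`corresponds_unitaryGroupCongr`). [cite: Rogawski1990, §14.1 p. 232] [cite: PlatonovRapinchuk1994, §2.3] -/
theorem exists_corresponds_diagonal_of_formCongr_eq_diagonal {H : Matrix n n K} (g : GL n K) (d : n → K)
    (hg : formCongr σ g H = Matrix.diagonal d) (U : GL n K) (u : n → K) (hU : (U : Matrix n n K) = Matrix.diagonal u)
    (hu : ∀ i, σ (u i) * u i = 1) :
    ∃ γ : unitaryGroup σ H,
      Corresponds σ (Matrix.diagonal d) H ⟨U, diagonal_mem_unitaryGroup_diagonal σ U u hU hu d⟩ γ :=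
  ⟨unitaryGroupCongr σ g H (Matrix.diagonal d) hg ⟨U, diagonal_mem_unitaryGroup_diagonal σ U u hU hu d⟩,
    corresponds_unitaryGroupCongr g hg _⟩

/-- The same partner, read as plain conjugacy in `GL`: `∃ γ ∈ U(σ, H)` with `diag(u) ∼ γ`. [cite: Rogawski1990, §14.1 p. 232] -/
theorem exists_isConj_mem_unitaryGroup_of_formCongr_eq_diagonal {H : Matrix n n K} (g : GL n K) (d : n → K)
    (hg : formCongr σ g H = Matrix.diagonal d) (U : GL n K) (u : n → K) (hU : (U : Matrix n n K) = Matrix.diagonal u)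
    (hu : ∀ i, σ (u i) * u i = 1) :
    ∃ γ : unitaryGroup σ H, IsConj U (γ : GL n K) := by
  obtain ⟨γ, hγ⟩ := exists_corresponds_diagonal_of_formCongr_eq_diagonal σ g d hg U u hU hu
  exact ⟨γ, hγ⟩

end CommRing

/-! ## §2 The torus `U(1) × U(1)`: partners for a diagonalisable plane, and the Weyl fibre -/

section Field

variable {K : Type*} [Field K] [NeZero (2 : K)] (σ : K →+* K)

omit [NeZero (2 : K)] in
/-- `det (1 1; 1 −1) = −2`. [folklore] -/
private theorem det_frame : Matrix.det !![(1 : K), 1; 1, -1] = -2 := by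
  rw [Matrix.det_fin_two_of]; ring

/-- `det (1 1; 1 −1) ≠ 0` when `2 ≠ 0`. [folklore] -/
private theorem det_frame_ne_zero : Matrix.det !![(1 : K), 1; 1, -1] ≠ 0 := by
  rw [det_frame]; exact neg_ne_zero.2 (NeZero.ne 2)

/-- **`torusGL(u₁, u₂) · P = P · diag(u₁, u₂)`** for the frame `P = (1 1; 1 −1)` — the matrix identity behind «`M(u₁, u₂) = P diag(u₁, u₂) P⁻¹`».
[cite: Rogawski1990, §4.6 Prop. 4.6.1] -/
theorem torusGL_mul_frame_eq (u : GL (Fin 1) K × GL (Fin 1) K) :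
    ((torusGL u : GL (Fin 2) K) : Matrix (Fin 2) (Fin 2) K) * !![(1 : K), 1; 1, -1] =
      !![(1 : K), 1; 1, -1] * Matrix.diagonal ![((u.1 : GL (Fin 1) K) : Matrix (Fin 1) (Fin 1) K) 0 0,
        ((u.2 : GL (Fin 1) K) : Matrix (Fin 1) (Fin 1) K) 0 0] := by
  have h2 : (2 : K) ≠ 0 := NeZero.ne 2
  rw [coe_torusGL, Matrix.GeneralLinearGroup.val_det_apply, Matrix.GeneralLinearGroup.val_det_apply, Matrix.det_fin_one,
    Matrix.det_fin_one, torusMatrix]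
  ext i j; fin_cases i <;> fin_cases j <;> simp [Matrix.mul_apply, Fin.sum_univ_two] <;> field_simp <;> ring

/-- **`torusGL(u₁, u₂)` is conjugate in `GL₂(K)` to any `U` with matrix `diag(u₁, u₂)`.** [cite: Rogawski1990, §4.6 Prop. 4.6.1] -/
theorem isConj_torusGL_of_coe_eq_diagonal (u : GL (Fin 1) K × GL (Fin 1) K) (U : GL (Fin 2) K)
    (hU : (U : Matrix (Fin 2) (Fin 2) K) = Matrix.diagonal ![((u.1 : GL (Fin 1) K) : Matrix (Fin 1) (Fin 1) K) 0 0,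
      ((u.2 : GL (Fin 1) K) : Matrix (Fin 1) (Fin 1) K) 0 0]) :
    IsConj (torusGL u) U := by
  set P : GL (Fin 2) K := Matrix.GeneralLinearGroup.mkOfDetNeZero !![(1 : K), 1; 1, -1] det_frame_ne_zero with hP
  have key : torusGL u * P = P * U := by
    refine Units.ext ?_
    rw [Units.val_mul, Units.val_mul, hP, Matrix.GeneralLinearGroup.val_mkOfDetNeZero, hU]
    exact torusGL_mul_frame_eq u
  refine isConj_iff.2 ⟨P⁻¹, ?_⟩
  rw [inv_inv, mul_assoc, key, ← mul_assoc, inv_mul_cancel, one_mul]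

omit [NeZero (2 : K)] in
/-- The entry of `u ∈ GL₁(K)` is non-zero. [folklore] -/
private theorem GL_fin_one_apply_ne_zero (x : GL (Fin 1) K) : (x : Matrix (Fin 1) (Fin 1) K) 0 0 ≠ 0 := by
  rw [← Matrix.det_fin_one (x : Matrix (Fin 1) (Fin 1) K), ← Matrix.GeneralLinearGroup.val_det_apply]
  exact (Matrix.GeneralLinearGroup.det x).ne_zero

omit [NeZero (2 : K)] in
/-- `det (diag(a, b)) = a b ≠ 0` for `a, b ≠ 0`. [folklore] -/
private theorem det_diagonal_two_ne_zero {a b : K} (ha : a ≠ 0) (hb : b ≠ 0) : (Matrix.diagonal ![a, b]).det ≠ 0 := by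
  rw [Matrix.det_diagonal, Fin.prod_univ_two]
  exact mul_ne_zero ha hb

/-- **Every class of the torus `U(σ, Φ₁) × U(σ, Φ₁)` has a `↔`-partner in `U(σ, H)` for a DIAGONALISABLE plane `H`** (`ᵗσ(g) H g = diag(d)`):
`torusEmb₂ (u₁, u₂) ↔ γ` for some `γ ∈ U(σ, H)` — namely `γ = g · diag(u₁, u₂) · g⁻¹` (§1), and `torusEmb₂ (u₁, u₂) ∼ diag(u₁, u₂)`.
[cite: Rogawski1990, §4.6 Prop. 4.6.1; §14.1 p. 232] [cite: PlatonovRapinchuk1994, §2.3] -/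
theorem exists_corresponds_torusEmb₂_of_formCongr_eq_diagonal {H : Matrix (Fin 2) (Fin 2) K} (g : GL (Fin 2) K) (d : Fin 2 → K)
    (hg : formCongr σ g H = Matrix.diagonal d)
    (u : ↥(unitaryGroup σ (Matrix.of fun i j : Fin 1 => if i.val + j.val + 1 = 1 then (1 : K) else 0)) ×
      ↥(unitaryGroup σ (Matrix.of fun i j : Fin 1 => if i.val + j.val + 1 = 1 then (1 : K) else 0))) :
    ∃ γ : unitaryGroup σ H,
      Corresponds σ (Matrix.of fun i j : Fin 2 => if i.val + j.val + 1 = 2 then (1 : K) else 0) H (torusEmb₂ σ u) γ := by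
  set a : K := ((u.1 : GL (Fin 1) K) : Matrix (Fin 1) (Fin 1) K) 0 0 with ha
  set b : K := ((u.2 : GL (Fin 1) K) : Matrix (Fin 1) (Fin 1) K) 0 0 with hb
  have ha0 : a ≠ 0 := GL_fin_one_apply_ne_zero (u.1 : GL (Fin 1) K)
  have hb0 : b ≠ 0 := GL_fin_one_apply_ne_zero (u.2 : GL (Fin 1) K)
  set U : GL (Fin 2) K := Matrix.GeneralLinearGroup.mkOfDetNeZero (Matrix.diagonal ![a, b]) (det_diagonal_two_ne_zero ha0 hb0) with hUdef
  have hU : (U : Matrix (Fin 2) (Fin 2) K) = Matrix.diagonal ![a, b] := by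
    rw [hUdef, Matrix.GeneralLinearGroup.val_mkOfDetNeZero]
  have hu : ∀ i, σ (![a, b] i) * ![a, b] i = 1 := by
    intro i
    fin_cases i
    · exact (mem_unitaryGroup_fin_one_iff σ (u.1 : GL (Fin 1) K)).1 u.1.2
    · exact (mem_unitaryGroup_fin_one_iff σ (u.2 : GL (Fin 1) K)).1 u.2.2
  obtain ⟨γ, hγ⟩ := exists_isConj_mem_unitaryGroup_of_formCongr_eq_diagonal σ g d hg U ![a, b] hU hu
  exact ⟨γ, (isConj_torusGL_of_coe_eq_diagonal ((u.1 : GL (Fin 1) K), (u.2 : GL (Fin 1) K)) U hU).trans hγ⟩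

/-! ### The Weyl fibre: at most two torus elements over one `γ ∈ U(σ, H)` -/

omit [NeZero (2 : K)] in
/-- A `1 × 1` invertible matrix is its entry. [folklore] -/
private theorem GL_fin_one_eq_of_apply_eq {x y : GL (Fin 1) K} (h : (x : Matrix (Fin 1) (Fin 1) K) 0 0 = (y : Matrix (Fin 1) (Fin 1) K) 0 0) :
    x = y := by
  refine Units.ext (Matrix.ext fun i j => ?_)
  fin_cases i; fin_cases j
  exact h

omit [NeZero (2 : K)] in
/-- Cancelling a monic linear factor: `(X − a)(X − b) = (X − a)(X − b′) ⇒ b = b′`. [folklore] -/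
private theorem eq_of_mul_X_sub_C_eq {a b b' : K} (h : (X - C a) * (X - C b) = (X - C a) * (X - C b')) : b = b' := by
  have h' := mul_left_cancel₀ (X_sub_C_ne_zero a) h
  have := congrArg (fun p : K[X] => p.eval 0) h'
  simp only [eval_sub, eval_X, eval_C, zero_sub, neg_inj] at this
  exact this

/-- **A torus element over `γ` is determined by its first coordinate** (`u₂` is the other root of `charpoly γ`). [cite: Rogawski1990, §5.4 pp. 72–73] -/
theorem eq_of_corresponds_torusEmb₂_of_fst_apply_eq {H : Matrix (Fin 2) (Fin 2) K} {γ : unitaryGroup σ H}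
    {u u' : ↥(unitaryGroup σ (Matrix.of fun i j : Fin 1 => if i.val + j.val + 1 = 1 then (1 : K) else 0)) ×
      ↥(unitaryGroup σ (Matrix.of fun i j : Fin 1 => if i.val + j.val + 1 = 1 then (1 : K) else 0))}
    (h : Corresponds σ (Matrix.of fun i j : Fin 2 => if i.val + j.val + 1 = 2 then (1 : K) else 0) H (torusEmb₂ σ u) γ)
    (h' : Corresponds σ (Matrix.of fun i j : Fin 2 => if i.val + j.val + 1 = 2 then (1 : K) else 0) H (torusEmb₂ σ u') γ)
    (he : ((u.1 : GL (Fin 1) K) : Matrix (Fin 1) (Fin 1) K) 0 0 = ((u'.1 : GL (Fin 1) K) : Matrix (Fin 1) (Fin 1) K) 0 0) : u = u' := by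
  have hc := h.charpoly_eq.trans h'.charpoly_eq.symm
  rw [coe_torusEmb₂, coe_torusEmb₂, charpoly_torusGL, charpoly_torusGL] at hc
  change (X - C (((u.1 : GL (Fin 1) K) : Matrix (Fin 1) (Fin 1) K) 0 0)) * (X - C (((u.2 : GL (Fin 1) K) : Matrix (Fin 1) (Fin 1) K) 0 0)) =
    (X - C (((u'.1 : GL (Fin 1) K) : Matrix (Fin 1) (Fin 1) K) 0 0)) * (X - C (((u'.2 : GL (Fin 1) K) : Matrix (Fin 1) (Fin 1) K) 0 0)) at hc
  rw [he] at hc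
  have h2 := eq_of_mul_X_sub_C_eq hc
  exact Prod.ext (Subtype.ext (GL_fin_one_eq_of_apply_eq he)) (Subtype.ext (GL_fin_one_eq_of_apply_eq h2))

/-- `u ↦ u₁` is injective on the torus elements over `γ`. [cite: Rogawski1990, §5.4 pp. 72–73] -/
theorem injOn_fst_apply_setOf_corresponds_torusEmb₂ {H : Matrix (Fin 2) (Fin 2) K} (γ : unitaryGroup σ H) :
    Set.InjOn (fun u : ↥(unitaryGroup σ (Matrix.of fun i j : Fin 1 => if i.val + j.val + 1 = 1 then (1 : K) else 0)) ×
        ↥(unitaryGroup σ (Matrix.of fun i j : Fin 1 => if i.val + j.val + 1 = 1 then (1 : K) else 0)) =>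
        ((u.1 : GL (Fin 1) K) : Matrix (Fin 1) (Fin 1) K) 0 0)
      {u | Corresponds σ (Matrix.of fun i j : Fin 2 => if i.val + j.val + 1 = 2 then (1 : K) else 0) H (torusEmb₂ σ u) γ} :=
  fun _ h _ h' he => eq_of_corresponds_torusEmb₂_of_fst_apply_eq σ h h' he

/-- `u₁` is a root of `charpoly γ`, which has at most `2` distinct roots. [cite: Rogawski1990, §5.4 pp. 72–73] -/
theorem mapsTo_fst_apply_setOf_corresponds_torusEmb₂ [DecidableEq K] {H : Matrix (Fin 2) (Fin 2) K} (γ : unitaryGroup σ H) :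
    Set.MapsTo (fun u : ↥(unitaryGroup σ (Matrix.of fun i j : Fin 1 => if i.val + j.val + 1 = 1 then (1 : K) else 0)) ×
        ↥(unitaryGroup σ (Matrix.of fun i j : Fin 1 => if i.val + j.val + 1 = 1 then (1 : K) else 0)) =>
        ((u.1 : GL (Fin 1) K) : Matrix (Fin 1) (Fin 1) K) 0 0)
      {u | Corresponds σ (Matrix.of fun i j : Fin 2 => if i.val + j.val + 1 = 2 then (1 : K) else 0) H (torusEmb₂ σ u) γ}
      ↑((((γ : GL (Fin 2) K) : Matrix (Fin 2) (Fin 2) K).charpoly).roots.toFinset) := by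
  intro u hu
  have hne : ((γ : GL (Fin 2) K) : Matrix (Fin 2) (Fin 2) K).charpoly ≠ 0 := (Matrix.charpoly_monic _).ne_zero
  have hc := (Corresponds.charpoly_eq hu).symm
  rw [coe_torusEmb₂, charpoly_torusGL] at hc
  rw [Finset.mem_coe, Multiset.mem_toFinset, Polynomial.mem_roots hne, Polynomial.IsRoot, hc, eval_mul, eval_sub, eval_X, eval_C, sub_self,
    zero_mul]

omit [NeZero (2 : K)] in
/-- `charpoly γ` has at most `2` distinct roots for `γ ∈ GL₂`. [folklore] -/
private theorem card_roots_charpoly_toFinset_le_two [DecidableEq K] (b : GL (Fin 2) K) :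
    ((b : Matrix (Fin 2) (Fin 2) K).charpoly.roots.toFinset).card ≤ 2 := by
  calc ((b : Matrix (Fin 2) (Fin 2) K).charpoly.roots.toFinset).card
      ≤ Multiset.card (b : Matrix (Fin 2) (Fin 2) K).charpoly.roots := Multiset.toFinset_card_le _
    _ ≤ (b : Matrix (Fin 2) (Fin 2) K).charpoly.natDegree := Polynomial.card_roots' _
    _ = 2 := by rw [Matrix.charpoly_natDegree_eq_dim, Fintype.card_fin]

/-- **FINITENESS of the Weyl fibre.** [cite: Rogawski1990, §5.4 pp. 72–73] -/
theorem finite_setOf_corresponds_torusEmb₂ {H : Matrix (Fin 2) (Fin 2) K} (γ : unitaryGroup σ H) :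
    {u : ↥(unitaryGroup σ (Matrix.of fun i j : Fin 1 => if i.val + j.val + 1 = 1 then (1 : K) else 0)) ×
        ↥(unitaryGroup σ (Matrix.of fun i j : Fin 1 => if i.val + j.val + 1 = 1 then (1 : K) else 0)) |
      Corresponds σ (Matrix.of fun i j : Fin 2 => if i.val + j.val + 1 = 2 then (1 : K) else 0) H (torusEmb₂ σ u) γ}.Finite := by
  classical
  exact Set.Finite.of_finite_image ((Finset.finite_toSet _).subset (mapsTo_fst_apply_setOf_corresponds_torusEmb₂ σ γ).image_subset)
    (injOn_fst_apply_setOf_corresponds_torusEmb₂ σ γ)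

/-- **AT MOST TWO torus elements lie over a given `γ ∈ U(σ, H)`** (the Weyl ambiguity `(u₁, u₂) ↔ (u₂, u₁)`). [cite: Rogawski1990, §5.4 pp. 72–73] -/
theorem ncard_setOf_corresponds_torusEmb₂_le_two {H : Matrix (Fin 2) (Fin 2) K} (γ : unitaryGroup σ H) :
    {u : ↥(unitaryGroup σ (Matrix.of fun i j : Fin 1 => if i.val + j.val + 1 = 1 then (1 : K) else 0)) ×
        ↥(unitaryGroup σ (Matrix.of fun i j : Fin 1 => if i.val + j.val + 1 = 1 then (1 : K) else 0)) |
      Corresponds σ (Matrix.of fun i j : Fin 2 => if i.val + j.val + 1 = 2 then (1 : K) else 0) H (torusEmb₂ σ u) γ}.ncard ≤ 2 := by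
  classical
  calc _ ≤ (↑((((γ : GL (Fin 2) K) : Matrix (Fin 2) (Fin 2) K).charpoly).roots.toFinset) : Set K).ncard :=
        Set.ncard_le_ncard_of_injOn _ (mapsTo_fst_apply_setOf_corresponds_torusEmb₂ σ γ)
          (injOn_fst_apply_setOf_corresponds_torusEmb₂ σ γ) (Finset.finite_toSet _)
    _ = ((((γ : GL (Fin 2) K) : Matrix (Fin 2) (Fin 2) K).charpoly).roots.toFinset).card := Set.ncard_coe_finset _
    _ ≤ 2 := card_roots_charpoly_toFinset_le_two (γ : GL (Fin 2) K)

end Field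

/-! ## §3 The CM dress: rational partners in `U(H)(L⁺)`, local partners in `U(H)(L⁺_v)` -/

section CM

variable (L : Type) [Field L] [NumberField L] [IsCMField L]

omit [NumberField L] [IsCMField L] in
/-- `!![b, 0; 0, a] = diag(b, a)`. [folklore] -/
private theorem diagTwo_eq_diagonal (b a : L) : !![b, 0; 0, a] = Matrix.diagonal ![b, a] := by
  ext i j; fin_cases i <;> fin_cases j <;> simp

/-- **A non-zero `c`-hermitian PLANE over a CM field is diagonalisable**: `ᵗc(B) · H · B = diag(d)` for some `B ∈ GL₂(L)` (a vector with
`⟨x, x⟩_H ≠ 0` exists by polarisation, ★ `exists_hermForm_self_ne_zero`; then the frame `(x⋆, x)`, ★ `exists_formCongr_eq_diagTwo_of_hermForm_self_ne_zero`).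
[cite: Scharlau1985HermitianForms, Ch. 7 §6] [cite: Rogawski1990, §3.2 p. 19] -/
theorem exists_formCongr_eq_diagonal_two (H : Matrix (Fin 2) (Fin 2) L) (hH : (H.map (cmConjRingHom L))ᵀ = H) (hH0 : H ≠ 0) :
    ∃ (B : GL (Fin 2) L) (d : Fin 2 → L), formCongr (cmConjRingHom L) B H = Matrix.diagonal d := by
  obtain ⟨x, hx⟩ := exists_hermForm_self_ne_zero L hH0
  have hσ : ∀ s : L, cmConjRingHom L (cmConjRingHom L s) = s := fun s => by
    rw [cmConjRingHom_apply, cmConjRingHom_apply, IsCMField.complexConj_apply_apply]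
  obtain ⟨B, b, -, hB⟩ :=
    Literature.NumberTheory.Automorphic.UnitaryGroup.exists_formCongr_eq_diagTwo_of_hermForm_self_ne_zero (cmConjRingHom L) hσ hH rfl hx
  exact ⟨B, ![b, hermForm (cmConjRingHom L) H x x], hB.trans (diagTwo_eq_diagonal L _ _)⟩

/-- **RATIONAL PARTNERS: every element of the endoscopic torus `U(1) × U(1)` corresponds to some `γ ∈ U(H)(L⁺)`, for EVERY non-zero
`c`-hermitian plane `H ∈ M₂(L)`** — `torusEmb₂ (u₁, u₂) ↔ γ`; in rank `2` every endoscopic class «occurs in `G′`» for every inner form.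
[cite: Rogawski1990, §14.1 p. 232; §4.6 Prop. 4.6.1] -/
theorem exists_corresponds_torusEmb₂_two (H : Matrix (Fin 2) (Fin 2) L) (hH : (H.map (cmConjRingHom L))ᵀ = H) (hH0 : H ≠ 0)
    (u : ↥(unitaryGroup (cmConjRingHom L) (Matrix.of fun i j : Fin 1 => if i.val + j.val + 1 = 1 then (1 : L) else 0)) ×
      ↥(unitaryGroup (cmConjRingHom L) (Matrix.of fun i j : Fin 1 => if i.val + j.val + 1 = 1 then (1 : L) else 0))) :
    ∃ γ : unitaryGroup (cmConjRingHom L) H,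
      Corresponds (cmConjRingHom L) (Matrix.of fun i j : Fin 2 => if i.val + j.val + 1 = 2 then (1 : L) else 0) H
        (torusEmb₂ (cmConjRingHom L) u) γ := by
  obtain ⟨B, d, hB⟩ := exists_formCongr_eq_diagonal_two L H hH hH0
  exact exists_corresponds_torusEmb₂_of_formCongr_eq_diagonal (cmConjRingHom L) B d hB u

/-- … so the stable class of every torus element OCCURS in `U(H)(L⁺)` (★ `StableClass.OccursIn`). [cite: Rogawski1990, §14.1 p. 232] -/
theorem occursIn_stableClassOf_torusEmb₂_two (H : Matrix (Fin 2) (Fin 2) L) (hH : (H.map (cmConjRingHom L))ᵀ = H) (hH0 : H ≠ 0)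
    (u : ↥(unitaryGroup (cmConjRingHom L) (Matrix.of fun i j : Fin 1 => if i.val + j.val + 1 = 1 then (1 : L) else 0)) ×
      ↥(unitaryGroup (cmConjRingHom L) (Matrix.of fun i j : Fin 1 => if i.val + j.val + 1 = 1 then (1 : L) else 0))) :
    (stableClassOf (cmConjRingHom L) (Matrix.of fun i j : Fin 2 => if i.val + j.val + 1 = 2 then (1 : L) else 0)
      (torusEmb₂ (cmConjRingHom L) u)).OccursIn H := by
  obtain ⟨γ, hγ⟩ := exists_corresponds_torusEmb₂_two L H hH hH0 u
  exact StableClass.occursIn_stableClassOf_iff.2 ⟨γ, corresponds_comm.1 hγ⟩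

/-- **LOCAL PARTNERS: every diagonal `diag(w₁, w₂) ∈ GL₂(L ⊗ L⁺_v)` with `(c ⊗ 1)(w_i) · w_i = 1` is conjugate to some `γ ∈ U(H)(L⁺_v)`**, for every
non-zero `c`-hermitian plane `H ∈ M₂(L)` and every finite place `v` of `L⁺` — the local diagonalisation is the image (★ `adelicForm_formCongr_map_adeleToLocal`)
of a rational one; §1 over the commutative ring `L ⊗ L⁺_v`.  (A local torus embedding `U(1)(L⁺_v)² → U(Φ₂)(L⁺_v)` over `L ⊗ L⁺_v` — the LEAD's definition —
has image conjugate to such diagonals, as `torusGL_mul_frame_eq` shows rationally.) [cite: Rogawski1990, §14.1 p. 232; §4.6 Prop. 4.6.1]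
[cite: PlatonovRapinchuk1994, §2.3] -/
theorem exists_isConj_mem_cmDatum_local_two (H : Matrix (Fin 2) (Fin 2) L) (hH : (H.map (cmConjRingHom L))ᵀ = H) (hH0 : H ≠ 0)
    (v : HeightOneSpectrum (𝓞 ↥(maximalRealSubfield L)))
    (U : GL (Fin 2) (Literature.NumberTheory.Automorphic.UnitaryGroup.LocalRing L v))
    (w : Fin 2 → Literature.NumberTheory.Automorphic.UnitaryGroup.LocalRing L v)
    (hU : U.val = Matrix.diagonal w)
    (hw : ∀ i, Literature.NumberTheory.Automorphic.UnitaryGroup.conjLocal L (IsCMField.complexConj L) v (w i) * w i = 1) :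
    ∃ γ : (Literature.NumberTheory.Automorphic.UnitaryGroup.cmDatum L 2 H).Local v,
      IsConj U (γ.val : GL (Fin 2) (Literature.NumberTheory.Automorphic.UnitaryGroup.LocalRing L v)) := by
  obtain ⟨B, d, hB⟩ := exists_formCongr_eq_diagonal_two L H hH hH0
  -- the rational diagonalisation read at `v`
  have hBv : formCongr (Literature.NumberTheory.Automorphic.UnitaryGroup.conjLocal L (IsCMField.complexConj L) v)
      (Literature.NumberTheory.Automorphic.UnitaryGroup.toLocalGL L v B)
      ((Literature.NumberTheory.Automorphic.UnitaryGroup.adelicForm L 2 H).map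
        (Literature.NumberTheory.Automorphic.UnitaryGroup.adeleToLocal L v)) =
      Matrix.diagonal (fun i => algebraMap L (Literature.NumberTheory.Automorphic.UnitaryGroup.LocalRing L v) (d i)) := by
    have h := Literature.NumberTheory.Automorphic.UnitaryGroup.adelicForm_formCongr_map_adeleToLocal L (IsCMField.complexConj L) v B H
    rw [← h]
    change (Literature.NumberTheory.Automorphic.UnitaryGroup.adelicForm L 2 (formCongr (cmConjRingHom L) B H)).map _ = _
    rw [hB, Literature.NumberTheory.Automorphic.UnitaryGroup.adelicForm_map_adeleToLocal, Matrix.diagonal_map (map_zero _)]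
  obtain ⟨γ, hγ⟩ := exists_isConj_mem_unitaryGroup_of_formCongr_eq_diagonal
    (Literature.NumberTheory.Automorphic.UnitaryGroup.conjLocal L (IsCMField.complexConj L) v)
    (Literature.NumberTheory.Automorphic.UnitaryGroup.toLocalGL L v B) _ hBv U w hU hw
  exact ⟨⟨γ.1, γ.2⟩, hγ⟩

end CM

end Literature.NumberTheory.Rogawski1990

end
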